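import Summits.Ventures.HodgeRepro.CyclicFourier

/-!
# Two odd primes: the lifting lemma for a divisor, a Bézout CRT, the rectangle identity and the periodicity dichotomy

Blind re-derivation cell `pub-hodge-repro`, seat `p1` (gen 8).  Toolkit for `CyclicTwoPrimesNoSingleClass.lean`
(cyclic groups of order `N = 2pq`, `p ≠ q` odd primes), on top of `CyclicFourier.lean`:

* `exists_eq_mul_of_mul_eq_zero` — in `ℤ/(ab)`, `a z = 0` forces `z ∈ b ℤ`;
* `shift_eq_of_char_dvd` — the lifting lemma of `CyclicPrimePowerNoSingleClass.shift_eq_of_char` for an arbitrary odd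
  divisor `g ∣ N/2` (`N = g P`, `P` even, `k'` coprime to `P`, `f` `P`-periodic, `ψ(g k' d) = −1` ⟹ `f(x + d) = f(x + N/2)`);
* `exists_crt` — if `u ≡ v (mod 2)` (as `pq (u − v) = 0`) then some `w` is `≡ u (mod 2q)` and `≡ v (mod 2p)`
  (`p (w − u) = 0`, `q (w − v) = 0`), via Bézout coefficients `p A + q B = 1`;
* `rect` — **rectangle identity**: if `𝓕f` is supported on `{2q k = 0} ∪ {2p k = 0}` then
  `f(x) − f(y) = f(x') − f(y')` whenever `p(x − x') = 0`, `p(y − y') = 0`, `q(x − y) = 0`, `q(x' − y') = 0`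
  (Fourier inversion: every `k` in the support kills one of the two differences);
* `periodic_dichotomy` — a `{0,1}`-valued, CM-antiperiodic function on `ℤ/2pq` satisfying the rectangle identity is
  `2p`-periodic or `2q`-periodic (parity bookkeeping through `ψ(pq · w) = ±1`).
-/

set_option autoImplicit false

open Finset AddChar ZMod
open scoped Pointwise

namespace HodgeRepro.CyclicQuad

variable {N : ℕ} [NeZero N]

/-! ### Arithmetic in `ℤ/N` -/

/-- If `N = a b` and `a z = 0` in `ℤ/N` then `z` is a multiple of `b`. -/
theorem exists_eq_mul_of_mul_eq_zero {a b : ℕ} (hN : N = a * b) (ha : 0 < a) (z : ZMod N)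
    (h : (a : ZMod N) * z = 0) : ∃ t : ℕ, z = (b : ZMod N) * t := by
  have hw : ((a * z.val : ℕ) : ZMod N) = 0 := by rw [Nat.cast_mul, ZMod.natCast_zmod_val]; exact h
  rw [ZMod.natCast_eq_zero_iff] at hw
  have hw2 : a * b ∣ a * z.val := by rw [← hN]; exact hw
  obtain ⟨t, ht⟩ := Nat.dvd_of_mul_dvd_mul_left ha hw2
  exact ⟨t, by rw [← ZMod.natCast_zmod_val z, ht, Nat.cast_mul]⟩

omit [NeZero N] in
/-- `(N : ℤ/N) = 0`, in the form `N = 2 m`. -/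
theorem natCast_two_mul_eq_zero {m : ℕ} (hN : N = 2 * m) : ((2 * m : ℕ) : ZMod N) = 0 := by
  rw [← hN, ZMod.natCast_self]

/-- **Bézout CRT.**  `N = 2pq`, `p, q` coprime: if `pq (u − v) = 0` then some `w` satisfies `p (w − u) = 0` and
`q (w − v) = 0`. -/
theorem exists_crt {p q : ℕ} (hN : N = 2 * (p * q)) (hpq : Nat.Coprime p q) (u v : ZMod N)
    (huv : ((p * q : ℕ) : ZMod N) * (u - v) = 0) :
    ∃ w : ZMod N, (p : ZMod N) * (w - u) = 0 ∧ (q : ZMod N) * (w - v) = 0 := by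
  have hpq0 : 0 < p * q :=
    Nat.pos_of_ne_zero (fun h0 => NeZero.ne N (by rw [hN, h0, Nat.mul_zero]))
  obtain ⟨t, ht⟩ := exists_eq_mul_of_mul_eq_zero (a := p * q) (b := 2) (by rw [hN]; ring) hpq0 (u - v) huv
  have hbez : (p : ℤ) * Nat.gcdA p q + (q : ℤ) * Nat.gcdB p q = 1 := by
    have h := Nat.gcd_eq_gcd_ab p q
    rw [hpq.gcd_eq_one] at h
    exact_mod_cast h.symm
  have hbezN : (p : ZMod N) * (Nat.gcdA p q : ZMod N) + (q : ZMod N) * (Nat.gcdB p q : ZMod N) = 1 := by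
    have h := congrArg (Int.cast : ℤ → ZMod N) hbez
    push_cast at h
    exact h
  have hN0 := natCast_two_mul_eq_zero hN
  refine ⟨u - (2 : ZMod N) * t * ((Nat.gcdB p q : ZMod N) * q), ?_, ?_⟩
  · have e : (p : ZMod N) * (u - 2 * t * ((Nat.gcdB p q : ZMod N) * q) - u) =
        -(((2 * (p * q) : ℕ) : ZMod N) * t * (Nat.gcdB p q : ZMod N)) := by push_cast; ring
    rw [e, hN0]; ring
  · have e1 : u - 2 * t * ((Nat.gcdB p q : ZMod N) * q) - v =
        (2 : ZMod N) * t * (1 - (q : ZMod N) * (Nat.gcdB p q : ZMod N)) := by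
      have h2 : u - v = (2 : ZMod N) * t := by rw [ht]; push_cast; ring
      linear_combination h2
    have e2 : (1 : ZMod N) - (q : ZMod N) * (Nat.gcdB p q : ZMod N) =
        (p : ZMod N) * (Nat.gcdA p q : ZMod N) := by linear_combination -hbezN
    rw [e1, e2]
    have e3 : (q : ZMod N) * (2 * t * ((p : ZMod N) * (Nat.gcdA p q : ZMod N))) =
        ((2 * (p * q) : ℕ) : ZMod N) * t * (Nat.gcdA p q : ZMod N) := by push_cast; ring
    rw [e3, hN0]; ring

/-! ### The lifting lemma for an odd divisor `g ∣ N/2` -/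

/-- **Lifting.**  `N = g P` with `g` odd, `P` even, `k'` coprime to `P`, `f` `P`-periodic, and `ψ(g k' d) = -1`: then
`f(x + d) = f(x + N/2)` for every `x`. -/
theorem shift_eq_of_char_dvd {m g P k' : ℕ} (hN : N = 2 * m) (hgm : g ∣ m) (hP : N = g * P)
    (hP2 : 2 ∣ P) (hg : Odd g) (hk' : Nat.Coprime k' P) (f : ZMod N → ℂ)
    (hper : ∀ x, f (x + (P : ZMod N)) = f x) (d : ZMod N)
    (hd : stdAddChar (((g * k' : ℕ) : ZMod N) * d) = -1) (x : ZMod N) :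
    f (x + d) = f (x + (m : ZMod N)) := by
  have hg0 : 0 < g := hg.pos
  have hzk : (stdAddChar ((g : ZMod N) * d)) ^ k' = -1 := by
    rw [← map_nsmul_eq_pow, nsmul_eq_mul, ← hd]
    congr 1; push_cast; ring
  have hzP : (stdAddChar ((g : ZMod N) * d)) ^ P = 1 := by
    rw [← map_nsmul_eq_pow, nsmul_eq_mul, ← mul_assoc, ← Nat.cast_mul, mul_comm P g, ← hP,
      ZMod.natCast_self, zero_mul, map_zero_eq_one]
  have hz1 := eq_neg_one_of_pow_eq_neg_one hzP hP2 hk' hzk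
  have h2 : (g : ZMod N) * d = (m : ZMod N) := (stdAddChar_eq_neg_one_iff hN _).mp hz1
  obtain ⟨m', hm'⟩ := hgm
  have h3 : (g : ZMod N) * (d - (m' : ZMod N)) = 0 := by
    rw [mul_sub, h2, hm', Nat.cast_mul, sub_self]
  obtain ⟨l, hl⟩ := exists_eq_mul_of_mul_eq_zero hP hg0 (d - (m' : ZMod N)) h3
  have hP' : P = 2 * m' := by
    have e : g * P = g * (2 * m') := by rw [← hP, hN, hm']; ring
    exact Nat.eq_of_mul_eq_mul_left hg0 e
  obtain ⟨t, ht⟩ := hg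
  have h4 : (m : ZMod N) = (m' : ZMod N) + (P : ZMod N) * (t : ZMod N) := by
    have e : m = m' + P * t := by rw [hP', hm', ht]; ring
    rw [e]; push_cast; ring
  have hd' : d = (m' : ZMod N) + (P : ZMod N) * l := by rw [← hl]; ring
  have key : ∀ (y : ZMod N) (n : ℕ), f (y + (P : ZMod N) * n) = f y := fun y n => by
    have := periodic_nsmul hper n y
    rwa [nsmul_eq_mul, mul_comm] at this
  rw [hd', h4, ← add_assoc, ← add_assoc, key, key]

/-! ### The rectangle identity -/

/-- Characters are constant along a coset of the kernel: if `N = c · P'`, `c (a − b) = 0` and `P' k = 0` then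
`ψ(k a) = ψ(k b)`. -/
theorem stdAddChar_mul_eq_of_ker {c P' : ℕ} (hNc : N = c * P') (hc : 0 < c) {a b : ZMod N}
    (hab : (c : ZMod N) * (a - b) = 0) {k : ZMod N} (hk : (P' : ZMod N) * k = 0) :
    stdAddChar (k * a) = stdAddChar (k * b) := by
  obtain ⟨t, ht⟩ := exists_eq_mul_of_mul_eq_zero hNc hc (a - b) hab
  have e : k * a = k * b + t * ((P' : ZMod N) * k) := by
    have : a = b + (P' : ZMod N) * t := by rw [← ht]; ring
    rw [this]; ring
  rw [e, hk, mul_zero, add_zero]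

/-- **Rectangle identity.**  `N = 2pq`; if `𝓕f` is supported on `{k : 2q k = 0} ∪ {k : 2p k = 0}`, then
`f(x) − f(y) = f(x') − f(y')` whenever `p(x − x') = 0`, `p(y − y') = 0`, `q(x − y) = 0`, `q(x' − y') = 0`. -/
theorem rect {p q : ℕ} (hNp : N = p * (2 * q)) (hNq : N = q * (2 * p)) (hp : 0 < p) (hq : 0 < q)
    (f : ZMod N → ℂ)
    (hsupp : ∀ k, ZMod.dft f k ≠ 0 → ((2 * q : ℕ) : ZMod N) * k = 0 ∨ ((2 * p : ℕ) : ZMod N) * k = 0)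
    {x y x' y' : ZMod N} (hx : (p : ZMod N) * (x - x') = 0) (hy : (p : ZMod N) * (y - y') = 0)
    (hxy : (q : ZMod N) * (x - y) = 0) (hxy' : (q : ZMod N) * (x' - y') = 0) :
    f x - f y = f x' - f y' := by
  rw [apply_eq_inv_sum f x, apply_eq_inv_sum f y, apply_eq_inv_sum f x', apply_eq_inv_sum f y',
    ← mul_sub, ← mul_sub, ← Finset.sum_sub_distrib, ← Finset.sum_sub_distrib]
  congr 1
  refine Finset.sum_congr rfl (fun k _ => ?_)
  by_cases hk : ZMod.dft f k = 0
  · rw [hk]; ring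
  · rcases hsupp k hk with h | h
    · rw [stdAddChar_mul_eq_of_ker hNp hp hx h, stdAddChar_mul_eq_of_ker hNp hp hy h]
    · rw [stdAddChar_mul_eq_of_ker hNq hq hxy h, stdAddChar_mul_eq_of_ker hNq hq hxy' h]; ring

/-! ### The periodicity dichotomy -/

/-- Four `{0,1}`-values with `a − b = c − d` and `a ≠ b` force `c = a`. -/
theorem eq_of_sub_eq_sub_of_ne {a b c d : ℂ} (ha : a = 0 ∨ a = 1) (hb : b = 0 ∨ b = 1)
    (hc : c = 0 ∨ c = 1) (hd : d = 0 ∨ d = 1) (h : a - b = c - d) (hab : a ≠ b) : c = a := by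
  rcases ha with rfl | rfl <;> rcases hb with rfl | rfl <;> rcases hc with rfl | rfl <;>
    rcases hd with rfl | rfl <;> first | exact absurd rfl hab | rfl | (norm_num at h)

/-- `ψ(N/2 · w)` is `±1`. -/
theorem stdAddChar_half_mul {m : ℕ} (hN : N = 2 * m) (w : ZMod N) :
    stdAddChar ((m : ZMod N) * w) = 1 ∨ stdAddChar ((m : ZMod N) * w) = -1 := by
  have h2 : stdAddChar ((m : ZMod N) * w) ^ 2 = 1 := by
    rw [← map_nsmul_eq_pow, nsmul_eq_mul, ← mul_assoc, ← Nat.cast_mul, natCast_two_mul_eq_zero hN,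
      zero_mul, map_zero_eq_one]
  exact sq_eq_one_iff.mp h2

/-- `ψ(N/2 · N/2) = -1` when `N/2` is odd. -/
theorem stdAddChar_half_mul_half {m : ℕ} (hN : N = 2 * m) (hm : Odd m) :
    stdAddChar ((m : ZMod N) * (m : ZMod N)) = -1 := by
  rw [← nsmul_eq_mul, map_nsmul_eq_pow, stdAddChar_half hN, hm.neg_one_pow]

/-- `ψ(N/2 · w) = 1` means `N/2 · w = 0`. -/
theorem half_mul_eq_zero_of_stdAddChar {m : ℕ} (w : ZMod N)
    (h : stdAddChar ((m : ZMod N) * w) = 1) : (m : ZMod N) * w = 0 :=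
  injective_stdAddChar (h.trans (map_zero_eq_one _).symm)

/-- **Dichotomy.**  `N = 2pq`, `p, q` coprime, `pq` odd; a `{0,1}`-valued `f` with the CM antiperiodicity and the
rectangle identity is `2p`-periodic (`q(x − y) = 0 → f x = f y`) or `2q`-periodic (`p(x − y) = 0 → f x = f y`). -/
theorem periodic_dichotomy {p q : ℕ} (hN : N = 2 * (p * q)) (hpq : Nat.Coprime p q) (hodd : Odd (p * q))
    (hp : 0 < p) (hq : 0 < q) (f : ZMod N → ℂ) (hf01 : ∀ x, f x = 0 ∨ f x = 1)
    (hanti : ∀ x, f (x + ((p * q : ℕ) : ZMod N)) = 1 - f x)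
    (hrect : ∀ x y x' y' : ZMod N, (p : ZMod N) * (x - x') = 0 → (p : ZMod N) * (y - y') = 0 →
      (q : ZMod N) * (x - y) = 0 → (q : ZMod N) * (x' - y') = 0 → f x - f y = f x' - f y') :
    (∀ x y, (q : ZMod N) * (x - y) = 0 → f x = f y) ∨
      (∀ x y, (p : ZMod N) * (x - y) = 0 → f x = f y) := by
  by_cases h2p : ∀ x y, (q : ZMod N) * (x - y) = 0 → f x = f y
  · exact Or.inl h2p
  right
  obtain ⟨x₀, y₀, hxy₀, hne₀⟩ : ∃ x₀ y₀ : ZMod N, (q : ZMod N) * (x₀ - y₀) = 0 ∧ f x₀ ≠ f y₀ := by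
    by_contra hcon
    apply h2p
    intro x y hxy
    by_contra hne
    exact hcon ⟨x, y, hxy, hne⟩
  set M : ZMod N := ((p * q : ℕ) : ZMod N) with hM
  have hNp : N = p * (2 * q) := by rw [hN]; ring
  have hNq : N = q * (2 * p) := by rw [hN]; ring
  have hN0 := natCast_two_mul_eq_zero hN
  -- `pq (a − b) = 0` follows from `p (a − b) = 0` or from `q (a − b) = 0`
  have hMp : ∀ {a b : ZMod N}, (p : ZMod N) * (a - b) = 0 → M * (a - b) = 0 := by
    intro a b h
    obtain ⟨t, ht⟩ := exists_eq_mul_of_mul_eq_zero hNp hp (a - b) h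
    rw [ht, hM]
    have e : ((p * q : ℕ) : ZMod N) * (((2 * q : ℕ) : ZMod N) * t) =
        ((2 * (p * q) : ℕ) : ZMod N) * ((q : ZMod N) * t) := by push_cast; ring
    rw [e, hN0, zero_mul]
  have hMq : ∀ {a b : ZMod N}, (q : ZMod N) * (a - b) = 0 → M * (a - b) = 0 := by
    intro a b h
    obtain ⟨t, ht⟩ := exists_eq_mul_of_mul_eq_zero hNq hq (a - b) h
    rw [ht, hM]
    have e : ((p * q : ℕ) : ZMod N) * (((2 * p : ℕ) : ZMod N) * t) =
        ((2 * (p * q) : ℕ) : ZMod N) * ((p : ZMod N) * t) := by push_cast; ring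
    rw [e, hN0, zero_mul]
  intro x x' hxx'
  -- a witness pair of the parity of `x`
  obtain ⟨x₁, y₁, hxy₁, hne₁, hpar₁⟩ : ∃ x₁ y₁ : ZMod N, (q : ZMod N) * (x₁ - y₁) = 0 ∧ f x₁ ≠ f y₁ ∧
      M * (x₁ - x) = 0 := by
    rcases stdAddChar_half_mul hN (x₀ - x) with h | h
    · exact ⟨x₀, y₀, hxy₀, hne₀, half_mul_eq_zero_of_stdAddChar _ h⟩
    · refine ⟨x₀ + M, y₀ + M, ?_, ?_, ?_⟩
      · rw [show x₀ + M - (y₀ + M) = x₀ - y₀ by ring]; exact hxy₀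
      · rw [hM, hanti, hanti]; intro h'; apply hne₀; linear_combination -h'
      · apply half_mul_eq_zero_of_stdAddChar
        rw [show (M : ZMod N) * (x₀ + M - x) = M * (x₀ - x) + M * M by ring, map_add_eq_mul, hM, h,
          stdAddChar_half_mul_half hN hodd]
        norm_num
  -- `f` is constant on the `2q`-class of `x₁`
  have hα : ∀ X, (p : ZMod N) * (X - x₁) = 0 → f X = f x₁ := by
    intro X hX
    have hpar : M * (y₁ - X) = 0 := by
      have e : y₁ - X = -(x₁ - y₁) + (x₁ - X) := by ring
      rw [e, mul_add, mul_neg, hMq hxy₁, hMp (by rw [← neg_sub, mul_neg, hX, neg_zero]), neg_zero,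
        add_zero]
    obtain ⟨Y, hY1, hY2⟩ := exists_crt hN hpq y₁ X hpar
    have h := hrect x₁ y₁ X Y (by rw [← neg_sub, mul_neg, hX, neg_zero])
      (by rw [← neg_sub, mul_neg, hY1, neg_zero]) hxy₁ (by rw [← neg_sub, mul_neg, hY2, neg_zero])
    exact eq_of_sub_eq_sub_of_ne (hf01 x₁) (hf01 y₁) (hf01 X) (hf01 Y) h hne₁
  -- `x ≡ x' (mod 2q)`: compare both with the class of `x₁`
  obtain ⟨Y, hY1, hY2⟩ := exists_crt hN hpq x₁ x hpar₁
  have hpar' : M * (x₁ - x') = 0 := by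
    have e : x₁ - x' = (x₁ - x) + (x - x') := by ring
    rw [e, mul_add, hpar₁, hMp hxx', add_zero]
  obtain ⟨Y', hY1', hY2'⟩ := exists_crt hN hpq x₁ x' hpar'
  have h := hrect x Y x' Y' hxx' (by
      have e : Y - Y' = (Y - x₁) - (Y' - x₁) := by ring
      rw [e, mul_sub, hY1, hY1', sub_zero])
    (by rw [← neg_sub, mul_neg, hY2, neg_zero]) (by rw [← neg_sub, mul_neg, hY2', neg_zero])
  have hY : f Y = f x₁ := hα Y hY1
  have hY' : f Y' = f x₁ := hα Y' hY1'
  linear_combination h + hY - hY'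

end HodgeRepro.CyclicQuad
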